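import Summits.CriticalPhenomena.CardyFormulaZ2.Theses.CardyBoundaryCoulombGas
import Summits.CriticalPhenomena.CardyFormulaZ2.Theorems.CardyBoundaryCoulombGasStripClusterRatesBetheKernelToolkit

/-!
# Gap lower bound for consecutive Bethe roots
# (line `two-cluster-rate-is-stationary-gap`, crux `StripClusterRates`, stmt-CriticalPhenomena-13878)

Condensation building block ("no clustering in momentum space") for the Bethe-asymptotics pillar:
along every ordered positive solution `w : Fin M → ℝ` of the ground-state Bethe equations of the open
staggered Temperley–Lieb(1) chain,
`N·F(w_j) - ∑_{l ≠ j} [G(w_j - w_l) + G(w_j + w_l)] = π (j+1)`,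
`F(w) = arctan((2+√3) tanh w) + arctan(tanh w)`, `G(x) = arctan(tanh x/√3)`,
consecutive roots are MORE than one bare quantum apart in `F`-units: `N·(F(w_{j+1}) - F(w_j)) > π`.

Proof (exact algebra + monotonicity). Subtracting the equations for `j' = j+1` and `j` and peeling the
partner root from each scattering sum gives the exact identity (`bu_gap_identity`)
`N·(F(w_{j'}) - F(w_j)) = π + 2·G(w_{j'} - w_j)
  + ∑_{l ∉ {j, j'}} ([G(w_{j'} - w_l) - G(w_j - w_l)] + [G(w_{j'} + w_l) - G(w_j + w_l)])`
(the cross brackets differ by `2·G(w_{j'} - w_j)` since `G` is odd); `G` is strictly increasing, so the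
sum is termwise nonnegative and `G(w_{j'} - w_j) > 0` (`w_{j'} > w_j`). Uses the landed Bethe kernel
toolkit (`bk_G_strictMono`, `bk_G_neg`, `bk_G_pos`) and Mathlib finite sums only.
-/

noncomputable section

namespace Summit.CriticalPhenomena.CardyFormulaZ2.Cruxes.StripClusterRates.TwoClusterRateIsStationaryGap

open scoped BigOperators

/-- Peeling the partner index: for `j ≠ j'`, the difference of the two "erased" sums at `j'` and at `j`
is the cross terms plus a single sum over the common index set `l ∉ {j, j'}`. [folklore] -/
theorem bu_erase_sum_sub_erase_sum {M : ℕ} (f : Fin M → Fin M → ℝ) {j j' : Fin M} (hne : j ≠ j') :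
    ∑ l ∈ Finset.univ.erase j', f j' l - ∑ l ∈ Finset.univ.erase j, f j l =
      f j' j - f j j' + ∑ l ∈ (Finset.univ.erase j).erase j', (f j' l - f j l) := by
  have hj : j ∈ Finset.univ.erase j' := Finset.mem_erase.2 ⟨hne, Finset.mem_univ j⟩
  have hj' : j' ∈ Finset.univ.erase j := Finset.mem_erase.2 ⟨hne.symm, Finset.mem_univ j'⟩
  rw [← Finset.add_sum_erase _ _ hj, ← Finset.add_sum_erase _ _ hj', Finset.erase_right_comm,
    Finset.sum_sub_distrib]
  ring

/-- The cross brackets differ by twice the scattering phase: for all `a, b`,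
`[G(b - a) + G(b + a)] - [G(a - b) + G(a + b)] = 2·G(b - a)` (`G` odd). [folklore] -/
theorem bu_bracket_cross_sub (a b : ℝ) :
    Real.arctan (Real.tanh (b - a) / Real.sqrt 3) + Real.arctan (Real.tanh (b + a) / Real.sqrt 3) -
        (Real.arctan (Real.tanh (a - b) / Real.sqrt 3) + Real.arctan (Real.tanh (a + b) / Real.sqrt 3)) =
      2 * Real.arctan (Real.tanh (b - a) / Real.sqrt 3) := by
  have h1 : Real.arctan (Real.tanh (a - b) / Real.sqrt 3) = -Real.arctan (Real.tanh (b - a) / Real.sqrt 3) := by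
    rw [← bk_G_neg, neg_sub]
  rw [h1, add_comm a b]
  ring

/-- The bracket `G(a - c) + G(a + c)` is monotone in `a`: its increment from `a` to `b ≥ a` is
nonnegative. [folklore] -/
theorem bu_bracket_sub_nonneg {a b : ℝ} (hab : a ≤ b) (c : ℝ) :
    0 ≤ Real.arctan (Real.tanh (b - c) / Real.sqrt 3) - Real.arctan (Real.tanh (a - c) / Real.sqrt 3) +
      (Real.arctan (Real.tanh (b + c) / Real.sqrt 3) - Real.arctan (Real.tanh (a + c) / Real.sqrt 3)) := by
  have h1 : Real.arctan (Real.tanh (a - c) / Real.sqrt 3) ≤ Real.arctan (Real.tanh (b - c) / Real.sqrt 3) :=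
    bk_G_strictMono.monotone (by linarith)
  have h2 : Real.arctan (Real.tanh (a + c) / Real.sqrt 3) ≤ Real.arctan (Real.tanh (b + c) / Real.sqrt 3) :=
    bk_G_strictMono.monotone (by linarith)
  linarith

/-- **Gap identity.** Along every solution of the ground-state Bethe equations (no ordering or positivity
needed), for `j' = j + 1`:
`N·(F(w_{j'}) - F(w_j)) = π + 2·G(w_{j'} - w_j)
  + ∑_{l ∉ {j, j'}} ([G(w_{j'} - w_l) - G(w_j - w_l)] + [G(w_{j'} + w_l) - G(w_j + w_l)])`. [folklore] -/
theorem bu_gap_identity {N M : ℕ} {w : Fin M → ℝ}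
    (heq : ∀ j : Fin M,
      (N : ℝ) * (Real.arctan ((2 + Real.sqrt 3) * Real.tanh (w j)) + Real.arctan (Real.tanh (w j))) -
      ∑ l ∈ Finset.univ.erase j,
        (Real.arctan (Real.tanh (w j - w l) / Real.sqrt 3) + Real.arctan (Real.tanh (w j + w l) / Real.sqrt 3)) =
      Real.pi * ((j : ℕ) + 1))
    {j j' : Fin M} (hjj' : (j : ℕ) + 1 = j') :
    (N : ℝ) * ((Real.arctan ((2 + Real.sqrt 3) * Real.tanh (w j')) + Real.arctan (Real.tanh (w j'))) -
        (Real.arctan ((2 + Real.sqrt 3) * Real.tanh (w j)) + Real.arctan (Real.tanh (w j)))) =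
      Real.pi + 2 * Real.arctan (Real.tanh (w j' - w j) / Real.sqrt 3) +
        ∑ l ∈ (Finset.univ.erase j).erase j',
          (Real.arctan (Real.tanh (w j' - w l) / Real.sqrt 3) - Real.arctan (Real.tanh (w j - w l) / Real.sqrt 3) +
            (Real.arctan (Real.tanh (w j' + w l) / Real.sqrt 3) -
              Real.arctan (Real.tanh (w j + w l) / Real.sqrt 3))) := by
  have hne : j ≠ j' := fun h => by rw [h] at hjj'; omega
  have hcast : ((j' : ℕ) : ℝ) = ((j : ℕ) : ℝ) + 1 := by
    rw [← hjj']; push_cast; ring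
  have hj := heq j
  have hj' := heq j'
  rw [hcast] at hj'
  have hsplit := bu_erase_sum_sub_erase_sum
    (fun a l => Real.arctan (Real.tanh (w a - w l) / Real.sqrt 3) + Real.arctan (Real.tanh (w a + w l) / Real.sqrt 3))
    hne
  have hcross := bu_bracket_cross_sub (w j) (w j')
  have hsum : ∑ l ∈ (Finset.univ.erase j).erase j',
      (Real.arctan (Real.tanh (w j' - w l) / Real.sqrt 3) + Real.arctan (Real.tanh (w j' + w l) / Real.sqrt 3) -
        (Real.arctan (Real.tanh (w j - w l) / Real.sqrt 3) + Real.arctan (Real.tanh (w j + w l) / Real.sqrt 3))) =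
      ∑ l ∈ (Finset.univ.erase j).erase j',
        (Real.arctan (Real.tanh (w j' - w l) / Real.sqrt 3) - Real.arctan (Real.tanh (w j - w l) / Real.sqrt 3) +
          (Real.arctan (Real.tanh (w j' + w l) / Real.sqrt 3) - Real.arctan (Real.tanh (w j + w l) / Real.sqrt 3))) :=
    Finset.sum_congr rfl fun l _ => by ring
  linear_combination hj' - hj + hsplit + hcross + hsum

/-- **Gap lower bound** (registered helper of `stmt-CriticalPhenomena-13878`, line
`two-cluster-rate-is-stationary-gap`; condensation step "momentum gaps exceed one quantum"): along every
ordered positive solution of the ground-state Bethe equations of the open staggered TL(1) chain, consecutive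
roots satisfy `π < N·(F(w_{j+1}) - F(w_j))`. [folklore] -/
theorem bu_gap_lower : ∀ (N M : ℕ) (w : Fin M → ℝ), (StrictMono w ∧ (∀ j, 0 < w j) ∧ ∀ j : Fin M, (N : ℝ) * (Real.arctan ((2 + Real.sqrt 3) * Real.tanh (w j)) + Real.arctan (Real.tanh (w j))) - ∑ l ∈ Finset.univ.erase j, (Real.arctan (Real.tanh (w j - w l) / Real.sqrt 3) + Real.arctan (Real.tanh (w j + w l) / Real.sqrt 3)) = Real.pi * ((j : ℕ) + 1)) → ∀ (j j' : Fin M), (j : ℕ) + 1 = j' → Real.pi < (N : ℝ) * ((Real.arctan ((2 + Real.sqrt 3) * Real.tanh (w j')) + Real.arctan (Real.tanh (w j'))) - (Real.arctan ((2 + Real.sqrt 3) * Real.tanh (w j)) + Real.arctan (Real.tanh (w j)))) := by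
  rintro N M w ⟨hmono, -, heq⟩ j j' hjj'
  have hlt : j < j' := Fin.lt_def.2 (by omega)
  have hw : w j < w j' := hmono hlt
  rw [bu_gap_identity heq hjj']
  have hG : 0 < Real.arctan (Real.tanh (w j' - w j) / Real.sqrt 3) := bk_G_pos (sub_pos.2 hw)
  have hS : 0 ≤ ∑ l ∈ (Finset.univ.erase j).erase j',
      (Real.arctan (Real.tanh (w j' - w l) / Real.sqrt 3) - Real.arctan (Real.tanh (w j - w l) / Real.sqrt 3) +
        (Real.arctan (Real.tanh (w j' + w l) / Real.sqrt 3) - Real.arctan (Real.tanh (w j + w l) / Real.sqrt 3))) :=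
    Finset.sum_nonneg fun l _ => bu_bracket_sub_nonneg hw.le (w l)
  linarith

end Summit.CriticalPhenomena.CardyFormulaZ2.Cruxes.StripClusterRates.TwoClusterRateIsStationaryGap

end
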